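import Summits.NavierStokesRegularity.NavierStokesRegularity.Theses.PumpContinuation
import Summits.NavierStokesRegularity.NavierStokesRegularity.Theorems.PumpContinuationEulerProximatePumpScalingTools
import Literature.Analysis.FluidPDE.TaoAveragedSobolevProofs
import Literature.Analysis.FluidPDE.TaoAveragedSobolevSymmetry
import Literature.Analysis.FluidPDE.TaoAveragedComplexAverageReal

/-!
# Disproof of `BoundedTemperatureClosed` — findings (birth vetting + crux disprover cycle 1, refuter, 2026-08-17)

Crux stmt-NavierStokesRegularity-18303 of route PumpContinuation:
`∀ 𝒜 sym canc, ∀ M, IsClosed (btSet (segForm 𝒜) M)` — closedness in the OPERATOR parameter `θ` of the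
set of bounded-temperature (Type-I constant `≤ M`) Schwartz-data `H¹⁰_df`-mild blow-up parameters of
the segment `T_θ = (1-θ)·B̃_𝒜 + θ·B`.

Findings (all sorry-free):

* (a) LOAD-BEARING ANALYSIS. `boundedTemperatureClosed_iff_noSymm`: the hypothesis `IsSymmetric` is
  DECORATION — the crux is equivalent to its version without it (symmetrise the datum: the mild
  formulation only evaluates `T(u,u)`, and `B̃ˢʸᵐ(u,u) = B̃(u,u)`, `symmetrize_form_diag`). Any proof
  may assume symmetry for free; any disproof may use non-symmetric data. `HasCancellation`: status
  unknown (plausibly load-bearing for the compactness of Type-I windows via the energy identity).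
* (b) DEGENERATE INSTANCES. `euler_instance`: at the Euler datum the segment is constant (`T_θ = B`,
  `segForm_euler`) and the crux holds with no analysis (`isClosed_btSet_const`: a `θ`-independent
  membership predicate gives `∅` or `Icc 0 1`). On paper (ATTACK.md): for the scaled Euler data
  `m₀ ≡ κ` (in particular the ZERO datum, `T_θ = θ·B`, amplitude rescaling `u ↦ θu`) the crux is
  EQUIVALENT to: "Navier–Stokes has no Schwartz-data `H¹⁰_df`-mild Type-I blow-up, or the infimal
  Type-I constant is attained" — open in both directions, and foreign to the line (`closes` uses the
  crux only at the Door's `(𝒜, M)` and only at the limit `θ → 1`, discarding the Type-I bound there).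
  Objection "over-quantified" of refuter-rreview-0817T02-10-0 UPHELD; repair on the item
  (`BoundedTemperatureClosedAtOne`, PumpContinuationRepair.lean).
* (c) NO UNCONDITIONAL KILL IS AVAILABLE TODAY (so later disprover cycles should not hunt one):
  `¬C` needs `(𝒜, M)` and DISTINCT parameters `θₙ → θ*` with actual mild blow-ups for `T_{θₙ}`.
  Every form with a PROVED blow-up is a positive multiple / symmetry image of a pure cascade form
  (Tao 2016 Thm 1.5; tree `AveragedTypeIBlowup_of`), and two distinct `θ, θ'` with `T_θ, T_θ'` of
  that kind force `T_θ' = α·k + β·B` with `β = (θ'-θ)/(1-θ) ≠ 0` — blow-up for a cascade form plus a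
  genuine Euler component, i.e. the Door's open persistence problem (or NS blow-up itself). Dually an
  unconditional PROOF must settle the zero-datum instance of (b). The crux is undecidable with present
  knowledge in both directions; planner's difficulty `L` is an underestimate for the statement AS
  QUANTIFIED (the zero-datum instance alone is an open NS problem).
* (d) Sanity: elaborates (rc 0); `simp`/`aesop`/`exact?` close neither `C` nor `¬C`; outer binders
  satisfiable (`hypotheses_satisfiable`); the set is not always empty (at `θ = 0` for the cascade datum
  of `AveragedTypeIBlowup_of`, `segForm_zero`), and is the NS Type-I set at `θ = 1` (`segForm_one`);
  `M ≤ 0` gives `∅` (Type-I bound forces `u ≡ 0`, hence `u₀ = 0`, and the zero solution extends) —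
  harmless; quantifier order matches the informal text; `IsClosed` is ambient in `ℝ` on a subset of
  `[0,1]` — fine.

* (e) **CYCLE 1 (cdisprove): the over-quantification objection of (b) is now KERNEL-CHECKED** (section (e)
  below). LANDED VERSIONS: the line lead's `Theorems/BoundedTemperatureClosed/Negative/ZeroDatumTools.lean`
  (`mem_btSet_iff_of_form_eq_zero`, `zero_not_mem_btSet_of_form_eq_zero`, `nsTypeI_mono`, `pos_of_nsTypeI`,
  `nsTypeI_of_forall_lt_of_boundedTemperatureClosed` = attainment, `not_forall_pos_nsTypeI_of_…` = temperature
  floor; companion `ZeroDatumDichotomy.lean` announced) reached independently the same hour; the Door disprover's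
  `Theorems/EulerProximatePump/Negative/HeatOnSegment.lean` (`continuousInH10On_heat`, `zero_isSymmetric`,
  `zero_hasCancellation`); this seat's delta `Negative/BoundedTemperatureClosedFalseOfTypeIInfimumNotAttainedNS.lean`
  (registered open statement `H` = `TypeIInfimumNotAttainedNS`, the negative lemma `…_false_of_…`, cold sector +
  `boundedTemperatureClosed_iff_pos`). The copies in section (e) below are this workfile's self-contained record. For the ZERO
  datum (`AveragingDatum.zero`, accepted Literature; symmetric + cancelling trivially) the segment is
  `T_θ = θ·B` (`segForm_zeroDatum`), and the landed amplitude-scaling covariance of Tao's mild formulation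
  (`PumpContinuationEulerProximatePump.typeIBlowup_smul`, `u ↦ θu`) gives, for `θ ∈ (0,1]`,
  `θ ∈ btSet (segForm zero) M ↔ NSTypeICeiling (θM)` (`mem_btSet_zeroDatum_iff`), and the heat point `θ = 0`
  is never a member (`zero_notMem_btSet_zeroDatum`, via strong continuity of `e^{tΔ}` in `H¹⁰`,
  `continuousInH10On_heat`, proved), so `btSet (segForm zero) M = {θ ∈ (0,1] | NSTypeICeiling (θM)}` EXACTLY
  (`btSet_zeroDatum_eq`, `isClosed_btSet_zeroDatum_iff`); here `NSTypeICeiling K` =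
  "the true Navier–Stokes form has a Schwartz-data `H¹⁰_df`-mild Type-I blow-up of constant `≤ K` with no
  mild extension" (the crux's own membership predicate at `θ = 1`). `NSTypeICeiling` is an up-set in `K`, so:
  `crux → ∀ K > 0, (∀ K' > K, NSTypeICeiling K') → NSTypeICeiling K` (`nsTypeICeiling_attained_of_crux`):
  ANY PROOF OF THE CRUX AS QUANTIFIED PROVES ATTAINMENT OF THE INFIMAL TYPE-I CONSTANT OF NAVIER–STOKES
  (or Type-I exclusion) — foreign to `closes`, out of reach of every card on file (= the ideators' `Attain`,
  BN0). Contrapositive = the negative lemma `crux_false_of_typeIInfimumNotAttainedNS : H → ¬crux`, `H` =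
  `TypeIInfimumNotAttainedNS` (some `K > 0` is not an NS Type-I ceiling though every `K' > K` is; contains a
  Millennium counterexample, not constructible here). The endpoint-only Type-I-free repair
  `BoundedTemperatureClosedAtOne` is NOT bitten by the zero datum (a member `θ < 1` rescales to an NS mild
  blow-up, which is all AtOne asks at `θ = 1`). PROVERS: do not attack `C` as quantified; prove AtOne /
  LossyClosed for the Door's datum. PLANNER: restate (two refuters + this lemma).
* (f) WHY NO UNCONDITIONAL KILL, sharpened. `¬C` needs a datum and DISTINCT members `θₙ → θ*` with `θ* ∉ S`.
  The only data whose segments have decidable structure today are those with `B̃_𝒜 ∝ B` (`κ`-Euler, zero,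
  `minusEuler` of the Door's Disproof: `T_θ = c(θ)·B`), and there membership is an NS Type-I fact at ceiling
  `|c(θ)|M` — unknown; accumulation at the heat point `c(θ*) = 0` would need NS Type-I blow-ups of
  arbitrarily SMALL constant, excluded by Leray's lower bound (`counterexample_typeI_constant_ge` family).
  Every other datum couples a genuine `θB` to `B̃_𝒜` for all but one `θ` (mixing a cascade form `K` with
  `γB` places ONE proved member, `T_θ* ∝ K`, never a sequence) = the Door's open persistence problem.
  Dropping `HasCancellation` does not change this (the obstruction is the `+θB` coupling, not energy), so
  `HasCancellation`'s status stays UNKNOWN (neither decoration nor shown load-bearing); `IsSymmetric` is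
  decoration ((a)). No finite/small model: the statement has no decidable instances (compute not used).
* (g) NATURAL STRENGTHENINGS, status: "closed for ALL averaging data (no cancellation)" — same obstruction,
  open; "closed AND attained uniformly in `M`" — equivalent for the zero datum; "the blow-up RELATION
  `{(θ,u₀)}` is closed in `[0,1] × 𝒮`" (card closed-relation-taming) — strictly stronger, inherits (e).

-- Targets (line `Sketch` PICKED 06:49; stubs `stub_lossyClosed : LossyClosed`, `stub_attain : Attain`; none STUCK
-- yet, lead returns the item as misstated). Status at the ZERO datum (all via §(e)): `Attain` at (zero, M, θ=1/2·…)
-- is NS ATTAINMENT (false modulo `TypeIInfimumNotAttainedNS`, exactly the negative lemma), and at (zero, M = 0,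
-- θ ∈ (0,1]) it asserts the NS TEMPERATURE FLOOR `¬ ∀ η > 0, nsTypeI[η]` (cold sector: S_0 = ∅) — open in the mild
-- class (true classically by Leray 1934); `LossyClosed` at the zero datum holds iff the same temperature floor holds
-- (closure of the up-ray adds its infimum θ₀, a member of S_{M+η} when θ₀ > 0; θ₀ = 0 would put the non-member heat
-- point in the closure). So BOTH stubs are hostage to open NS statements at the zero datum; neither is refutable
-- unconditionally, neither provable. `stub_attain_false_of_typeIInfimumNotAttainedNS` would be a 5-line corollary of
-- p146867 + `mem_btSet_iff_of_form_eq_zero` if the lead asks (disprover-wanted: none).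
-- Near-misses: none claimed (no `sorry`).
-/

noncomputable section

open MeasureTheory Set Filter Topology
open scoped ENNReal
open Literature.Analysis.FluidPDE Literature.Analysis.FluidPDE.Tao2016

-- nested summit namespace is the tree layout (D-0017)
set_option linter.dupNamespace false

namespace Summit.NavierStokesRegularity.NavierStokesRegularity.Cruxes.BoundedTemperatureClosed.Disproof

/-! ### The pieces of the crux, named -/

/-- The segment of trilinear forms `T_θ = (1-θ)·B̃_𝒜 + θ·B` of the route, as a `θ`-family. -/
def segForm (𝒜 : AveragingDatum) (θ : ℝ) : L2C → L2C → L2C → ℂ :=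
  fun a b c => ((1 - θ : ℝ) : ℂ) * 𝒜.form a b c + ((θ : ℝ) : ℂ) * eulerForm a b c

/-- The bounded-temperature blow-up set of a `θ`-family of forms `T` at ceiling `M`: the `θ ∈ [0,1]`
at which `T θ` has a Schwartz-data `H¹⁰_df`-mild solution on `[0,S)` with the Type-I bound
`‖u t‖_∞ ≤ M/√(S-t)` and no mild extension past `S` (verbatim body of the crux). -/
def btSet (T : ℝ → L2C → L2C → L2C → ℂ) (M : ℝ) : Set ℝ :=
  {θ : ℝ | θ ∈ Icc (0 : ℝ) 1 ∧
    ∃ u₀ : SchwartzMap (EuclideanSpace ℝ (Fin 3)) (EuclideanSpace ℝ (Fin 3)),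
      VectorCalculus.IsDivFree ⇑u₀ ∧ ∃ S : ℝ, 0 < S ∧ ∃ u : ℝ → L2C,
        IsMildSolutionFor (T θ) (schwartzL2 u₀) (Ico 0 S) u ∧
        (∀ t ∈ Ico 0 S, eLpNorm (u t) ⊤ volume ≤ ENNReal.ofReal (M / Real.sqrt (S - t))) ∧
        ¬ ∃ S' : ℝ, S < S' ∧ ∃ v : ℝ → L2C,
          IsMildSolutionFor (T θ) (schwartzL2 u₀) (Ico 0 S') v ∧ ∀ t ∈ Ico 0 S, v t = u t}

/-- The crux, read through `btSet`/`segForm` (definitional). -/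
theorem boundedTemperatureClosed_iff :
    Theses.PumpContinuation.BoundedTemperatureClosed ↔
      ∀ 𝒜 : AveragingDatum, 𝒜.IsSymmetric → 𝒜.HasCancellation →
        ∀ M : ℝ, IsClosed (btSet (segForm 𝒜) M) :=
  Iff.rfl

/-- The crux WITHOUT the symmetry hypothesis. -/
def BoundedTemperatureClosedWithoutIsSymmetric : Prop :=
  ∀ 𝒜 : AveragingDatum, 𝒜.HasCancellation → ∀ M : ℝ, IsClosed (btSet (segForm 𝒜) M)

/-! ### (b) Degenerate instances: constant segments, the Euler datum -/

/-- If the family of forms does not depend on `θ`, the bounded-temperature blow-up set is `∅` or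
`Icc 0 1`, hence closed — no analysis involved. -/
theorem isClosed_btSet_const (T : L2C → L2C → L2C → ℂ) (M : ℝ) :
    IsClosed (btSet (fun _ => T) M) := by
  rcases (btSet (fun _ => T) M).eq_empty_or_nonempty with h0 | ⟨θ₀, hθ₀⟩
  · rw [h0]
    exact isClosed_empty
  · have h : btSet (fun _ => T) M = Icc 0 1 :=
      Subset.antisymm (fun θ hθ => hθ.1) (fun θ hθ => ⟨hθ, hθ₀.2⟩)
    rw [h]
    exact isClosed_Icc

/-- For the Euler datum the segment is constant: `T_θ = (1-θ)B + θB = B`. -/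
theorem segForm_euler (θ : ℝ) : segForm AveragingDatum.euler θ = eulerForm := by
  funext a b c
  simp only [segForm, AveragingDatum.euler_form]
  push_cast
  ring

/-- **Degenerate instance (A4 probe).** At the Euler datum — a symmetric cancelling averaging datum —
the crux's closedness holds unconditionally, using neither symmetry nor cancellation nor any PDE:
the set is `∅` or `[0,1]` according as Navier–Stokes has a Schwartz-data mild Type-I blow-up of
constant `≤ M` or not. -/
theorem euler_instance (M : ℝ) : IsClosed (btSet (segForm AveragingDatum.euler) M) := by
  have h : segForm AveragingDatum.euler = fun _ => eulerForm := funext segForm_euler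
  rw [h]
  exact isClosed_btSet_const _ _

/-! ### (a) Load-bearing analysis: `IsSymmetric` is decoration -/

/-- Mild solutions only see the diagonal `T(u,u)`: two trilinear forms that agree on the diagonal of
the first two slots have the same mild solutions. -/
theorem isMildSolutionFor_congr_diag {T T' : L2C → L2C → L2C → ℂ} (h : ∀ a c, T a a c = T' a a c)
    {u₀ : L2C} {I : Set ℝ} {u : ℝ → L2C} :
    IsMildSolutionFor T u₀ I u ↔ IsMildSolutionFor T' u₀ I u := by
  unfold IsMildSolutionFor
  simp only [h]

/-- On the diagonal of the first two slots the symmetrisation changes nothing: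
`⟨B̃ˢʸᵐ(u,u), w⟩ = ⟨B̃(u,u), w⟩`, unconditionally (same proof as `symmetrize_form_self`). -/
theorem symmetrize_form_diag (𝒜 : AveragingDatum) (u w : L2C) :
    𝒜.symmetrize.form u u w = 𝒜.form u u w := by
  have key : ∀ p : 𝒜.Ω × Bool,
      eulerForm (𝒜.symmetrize.slot 0 p u) (𝒜.symmetrize.slot 1 p u) (𝒜.symmetrize.slot 2 p w) =
      eulerForm (𝒜.slot 0 p.1 u) (𝒜.slot 1 p.1 u) (𝒜.slot 2 p.1 w) := by
    rintro ⟨θ, b⟩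
    cases b
    · rfl
    · simp only [AveragingDatum.symmetrize_slot, AveragingDatum.swapSlot_true_zero,
        AveragingDatum.swapSlot_true_one, AveragingDatum.swapSlot_true_two]
      exact eulerForm_symm _ _ _
  have h : ∫ p, eulerForm (𝒜.symmetrize.slot 0 p u) (𝒜.symmetrize.slot 1 p u)
      (𝒜.symmetrize.slot 2 p w) ∂𝒜.coinMeasure =
      ∫ p, eulerForm (𝒜.slot 0 p.1 u) (𝒜.slot 1 p.1 u) (𝒜.slot 2 p.1 w) ∂𝒜.coinMeasure :=
    integral_congr_ae (Filter.Eventually.of_forall key)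
  exact h.trans (𝒜.integral_coinMeasure_comp_fst
    fun θ => eulerForm (𝒜.slot 0 θ u) (𝒜.slot 1 θ u) (𝒜.slot 2 θ w))

/-- The segment forms of `𝒜` and of its symmetrisation agree on the diagonal. -/
theorem segForm_symmetrize_diag (𝒜 : AveragingDatum) (θ : ℝ) (a c : L2C) :
    segForm 𝒜.symmetrize θ a a c = segForm 𝒜 θ a a c := by
  simp only [segForm, symmetrize_form_diag]

/-- Hence the bounded-temperature blow-up sets of `𝒜` and of `𝒜.symmetrize` coincide. -/
theorem btSet_symmetrize (𝒜 : AveragingDatum) (M : ℝ) :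
    btSet (segForm 𝒜.symmetrize) M = btSet (segForm 𝒜) M := by
  ext θ
  simp only [btSet, mem_setOf_eq,
    isMildSolutionFor_congr_diag (segForm_symmetrize_diag 𝒜 θ)]

/-- **`IsSymmetric` is decoration (hypothesis-mutation finding, proved).** The crux is equivalent to
its version without the symmetry hypothesis: given a cancelling datum, apply the crux to its
symmetrisation (symmetric, `symmetrize_isSymmetric`; cancelling iff, `symmetrize_hasCancellation_iff`)
and transport along `btSet_symmetrize`. -/
theorem boundedTemperatureClosed_iff_noSymm :
    Theses.PumpContinuation.BoundedTemperatureClosed ↔ BoundedTemperatureClosedWithoutIsSymmetric := by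
  constructor
  · intro h 𝒜 hc M
    rw [← btSet_symmetrize]
    exact h 𝒜.symmetrize 𝒜.symmetrize_isSymmetric (𝒜.symmetrize_hasCancellation_iff.2 hc) M
  · intro h 𝒜 _ hc M
    exact h 𝒜 hc M

/-! ### (d) Sanity -/

/-- **Non-vacuity of the outer binders**: symmetric cancelling averaging data exist (the Euler datum;
also the m = 2 Toda cascade datum of `AveragedTypeIBlowup_of`). -/
theorem hypotheses_satisfiable :
    ∃ 𝒜 : AveragingDatum, 𝒜.IsSymmetric ∧ 𝒜.HasCancellation :=
  AveragingDatum.exists_isSymmetric_and_hasCancellation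

/-- At the LEFT endpoint `θ = 0` the membership predicate of `btSet` is the pure averaged equation of
`𝒜` (so for the cascade datum of `AveragedTypeIBlowup_of` the set contains `0` once `M` exceeds that
witness's Type-I constant — the crux is not about empty sets only). -/
theorem segForm_zero (𝒜 : AveragingDatum) : segForm 𝒜 0 = 𝒜.form := by
  funext a b c
  simp [segForm]

/-- … and at the RIGHT endpoint `θ = 1` it is the true Navier–Stokes (Euler) form. -/
theorem segForm_one (𝒜 : AveragingDatum) : segForm 𝒜 1 = eulerForm := by
  funext a b c
  simp [segForm]

/-! ### (b') Cycle 1: the cold sector `M ≤ 0` is empty (closedness free there) -/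

/-- **Cold sector.** For `M ≤ 0` the bounded-temperature blow-up set of ANY `θ`-family of forms killing the
zero field in the first slot is empty: the Type-I bound forces `u t = 0` in `L²` on `[0,S)`, the mild identity
at `t = 0` gives `⟨u₀, w⟩ = 0` on `H¹⁰_df`, so `⟨e^{tΔ}u₀, w⟩ = ⟨u₀, e^{tΔ}w⟩ = 0` and `v ≡ 0` extends to
`[0,S+1)` (the Door disprover's `typeIBlowupFor_pos`, run on this crux's set). -/
theorem btSet_eq_empty_of_nonpos {T : ℝ → L2C → L2C → L2C → ℂ} (hT : ∀ θ v w, T θ 0 v w = 0) {M : ℝ}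
    (hM : M ≤ 0) : btSet T M = ∅ := by
  ext θ
  simp only [btSet, mem_setOf_eq, mem_empty_iff_false, iff_false]
  rintro ⟨-, u₀, -, S, hS, u, hu, hrate, hno⟩
  have hzero : ∀ t ∈ Ico 0 S, u t = 0 := by
    intro t ht
    have h0 : ENNReal.ofReal (M / Real.sqrt (S - t)) = 0 :=
      ENNReal.ofReal_eq_zero.2 (div_nonpos_of_nonpos_of_nonneg hM (Real.sqrt_nonneg _))
    have h1 : eLpNorm (u t) ⊤ volume = 0 := nonpos_iff_eq_zero.1 (h0 ▸ hrate t ht)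
    rw [eLpNorm_eq_zero_iff (Lp.aestronglyMeasurable (u t)) ENNReal.top_ne_zero] at h1
    exact Lp.eq_zero_iff_ae_eq_zero.2 h1
  have horth : ∀ w, MemH10df w → pairing (schwartzL2 u₀) w = 0 := by
    intro w hw
    have h := hu.2.2 0 ⟨le_rfl, hS⟩ w hw
    rw [hzero 0 ⟨le_rfl, hS⟩, intervalIntegral.integral_same, add_zero, heat_zero,
      pairing_zero_left] at h
    exact h.symm
  refine hno ⟨S + 1, by linarith, fun _ => 0, ⟨fun _ _ => memH10df_zero, continuousInH10On_zero _,
    fun t _ w hw => ?_⟩, fun t ht => (hzero t ht).symm⟩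
  simp only [hT, intervalIntegral.integral_zero, add_zero, pairing_zero_left]
  rw [pairing_heat_left]
  exact (horth _ (hw.heat t)).symm

/-- The segment forms kill the zero field in the first slot. -/
theorem segForm_zero_left (𝒜 : AveragingDatum) (θ : ℝ) (v w : L2C) : segForm 𝒜 θ 0 v w = 0 := by
  simp [segForm, AveragingDatum.form_zero_left, eulerForm_zero_left]

/-- Hence for `M ≤ 0` the crux's closedness is free (empty set): the `∀ M` is active only for `M > 0`. -/
theorem isClosed_btSet_segForm_of_nonpos (𝒜 : AveragingDatum) {M : ℝ} (hM : M ≤ 0) :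
    IsClosed (btSet (segForm 𝒜) M) := by
  rw [btSet_eq_empty_of_nonpos (segForm_zero_left 𝒜) hM]
  exact isClosed_empty

/-! ### (e) Cycle 1: the zero-datum instance is an NS attainment statement (kernel-checked)

Self-contained copy (this workfile cannot import the Negative file before it lands); the landed version is
`Theorems/BoundedTemperatureClosed/Negative/BoundedTemperatureClosedFalseOfTypeIInfimumNotAttainedNS.lean`. -/

section ZeroDatum

open Summit.NavierStokesRegularity.NavierStokesRegularity.Theorems.PumpContinuationEulerProximatePump
  (typeIBlowup_smul)

/-- **NS Type-I ceiling `K`**: the true Navier–Stokes form has a Schwartz-data `H¹⁰_df`-mild solution on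
`[0,S)` with `‖u t‖_∞ ≤ K/√(S-t)` and no mild extension — the crux's membership predicate at `θ = 1`. -/
def NSTypeICeiling (K : ℝ) : Prop :=
  ∃ u₀ : SchwartzMap (EuclideanSpace ℝ (Fin 3)) (EuclideanSpace ℝ (Fin 3)),
    VectorCalculus.IsDivFree ⇑u₀ ∧ ∃ S : ℝ, 0 < S ∧ ∃ u : ℝ → L2C,
      IsMildSolutionFor eulerForm (schwartzL2 u₀) (Ico 0 S) u ∧
      (∀ t ∈ Ico 0 S, eLpNorm (u t) ⊤ volume ≤ ENNReal.ofReal (K / Real.sqrt (S - t))) ∧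
      ¬ ∃ S' : ℝ, S < S' ∧ ∃ v : ℝ → L2C,
        IsMildSolutionFor eulerForm (schwartzL2 u₀) (Ico 0 S') v ∧ ∀ t ∈ Ico 0 S, v t = u t

/-- NS Type-I ceilings form an up-set in `K` (same witness, weaker bound). -/
theorem nsTypeICeiling_mono {K K' : ℝ} (hKK' : K ≤ K') (h : NSTypeICeiling K) : NSTypeICeiling K' := by
  obtain ⟨u₀, hdiv, S, hS, u, hu, hrate, hno⟩ := h
  refine ⟨u₀, hdiv, S, hS, u, hu, fun t ht => (hrate t ht).trans ?_, hno⟩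
  exact ENNReal.ofReal_le_ofReal (div_le_div_of_nonneg_right hKK' (Real.sqrt_nonneg _))

/-- The zero datum (`mᵢ ≡ 0`, accepted `AveragingDatum.zero`) is symmetric and cancelling, trivially. -/
theorem zeroDatum_isSymmetric_hasCancellation :
    AveragingDatum.zero.IsSymmetric ∧ AveragingDatum.zero.HasCancellation :=
  ⟨fun u v w _ _ _ => by rw [AveragingDatum.zero_form, AveragingDatum.zero_form],
    fun u _ => AveragingDatum.zero_form u u u⟩

/-- **The segment of the zero datum is `T_θ = θ·B`.** -/
theorem segForm_zeroDatum (θ : ℝ) :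
    segForm AveragingDatum.zero θ = fun a b c => ((θ : ℝ) : ℂ) * eulerForm a b c := by
  funext a b c
  simp [segForm, AveragingDatum.zero_form]

/-- `⟨B(c a, c b), w⟩ = c² ⟨B(a,b), w⟩`. -/
theorem eulerForm_smul_smul_eq (c : ℂ) (a b w : L2C) :
    eulerForm (c • a) (c • b) w = c ^ 2 * eulerForm a b w := by
  rw [eulerForm_smul₁, eulerForm_symm a, eulerForm_smul₁, eulerForm_symm b]
  ring

/-- **Zero-datum membership = NS Type-I ceiling, rescaled**: for `θ ∈ (0,1]`,
`θ ∈ btSet (segForm zero) M ↔ NSTypeICeiling (θ·M)` (amplitude scaling `u ↦ θ^{±1} u`, landed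
`typeIBlowup_smul`). -/
theorem mem_btSet_zeroDatum_iff {θ M : ℝ} (hθ0 : 0 < θ) (hθ1 : θ ≤ 1) :
    θ ∈ btSet (segForm AveragingDatum.zero) M ↔ NSTypeICeiling (θ * M) := by
  simp only [btSet, mem_setOf_eq, segForm_zeroDatum]
  constructor
  · rintro ⟨-, h⟩
    have hT : ∀ a b w : L2C, eulerForm (((θ : ℝ) : ℂ) • a) (((θ : ℝ) : ℂ) • b) w =
        ((θ : ℝ) : ℂ) * (fun a b c => ((θ : ℝ) : ℂ) * eulerForm a b c) a b w := by
      intro a b w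
      rw [eulerForm_smul_smul_eq]
      ring
    exact typeIBlowup_smul (fun a b c => ((θ : ℝ) : ℂ) * eulerForm a b c) eulerForm θ hθ0 hT M h
  · intro h
    have hθ : θ ≠ 0 := hθ0.ne'
    have hT : ∀ a b w : L2C, (fun a b c => ((θ : ℝ) : ℂ) * eulerForm a b c)
        (((θ⁻¹ : ℝ) : ℂ) • a) (((θ⁻¹ : ℝ) : ℂ) • b) w = ((θ⁻¹ : ℝ) : ℂ) * eulerForm a b w := by
      intro a b w
      have hθC : ((θ : ℝ) : ℂ) ≠ 0 := Complex.ofReal_ne_zero.2 hθ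
      show ((θ : ℝ) : ℂ) * eulerForm (((θ⁻¹ : ℝ) : ℂ) • a) (((θ⁻¹ : ℝ) : ℂ) • b) w = _
      rw [eulerForm_smul_smul_eq]
      push_cast
      field_simp
    obtain ⟨u₀, hdiv, S, hS, u, hu, hrate, hno⟩ :=
      typeIBlowup_smul eulerForm (fun a b c => ((θ : ℝ) : ℂ) * eulerForm a b c) θ⁻¹ (inv_pos.2 hθ0) hT
        (θ * M) h
    have hc : θ⁻¹ * (θ * M) = M := by
      field_simp
    refine ⟨⟨hθ0.le, hθ1⟩, u₀, hdiv, S, hS, u, hu, fun t ht => ?_, hno⟩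
    have h1 := hrate t ht
    rwa [hc] at h1

/-- The heat symbol is continuous in time at fixed frequency. -/
theorem continuous_heatSymbol_time (ξ : EuclideanSpace ℝ (Fin 3)) : Continuous fun τ : ℝ => heatSymbol τ ξ := by
  unfold heatSymbol
  refine Complex.continuous_ofReal.comp (Real.continuous_exp.comp ?_)
  exact ((continuous_const.mul (continuous_id.max continuous_const)).mul continuous_const).neg

/-- `𝓕(e^{tΔ}y − e^{t₀Δ}y) = (h_t − h_{t₀}) ŷ` a.e. -/
theorem fourierFn_heat_sub_heat (t t₀ : ℝ) (y : L2C) :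
    fourierFn (heat t y - heat t₀ y) =ᵐ[volume]
      fun ξ => (heatSymbol t ξ - heatSymbol t₀ ξ) • fourierFn y ξ := by
  have h : heat t y - heat t₀ y = heat t y + (-1 : ℂ) • heat t₀ y := by
    rw [neg_one_smul, sub_eq_add_neg]
  rw [h]
  filter_upwards [fourierFn_add (heat t y) ((-1 : ℂ) • heat t₀ y), fourierFn_smul (-1 : ℂ) (heat t₀ y),
    fourierFn_heat t y, fourierFn_heat t₀ y] with ξ h1 h2 h3 h4
  rw [h1, h2, h4, h3, sub_smul, neg_one_smul, sub_eq_add_neg]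

/-- **Strong continuity of the heat flow in `H^s`** (dominated convergence on the Fourier side):
`‖e^{tΔ}y − e^{t₀Δ}y‖_{H^s} → 0` as `t → t₀` whenever `‖y‖_{H^s} < ∞`. Provers: this is the `T = 0`
case of the continuous-dependence machinery every compactness stub of this crux needs. -/
theorem tendsto_eFourierSobolevNorm_heat_sub {s : ℝ} {y : L2C}
    (hy : Literature.Analysis.FunctionSpaces.eFourierSobolevNorm s y < ∞) (t₀ : ℝ) :
    Tendsto (fun t => Literature.Analysis.FunctionSpaces.eFourierSobolevNorm s (heat t y - heat t₀ y))
      (𝓝 t₀) (𝓝 0) := by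
  set G : EuclideanSpace ℝ (Fin 3) → ℝ≥0∞ :=
    fun ξ => ENNReal.ofReal ((1 + ‖ξ‖ ^ 2) ^ s) * ‖fourierFn y ξ‖ₑ ^ 2 with hG
  have hGfin : ∫⁻ ξ, G ξ < ∞ := (eFourierSobolevNorm_lt_top_iff s y).1 hy
  have hGmeas : Measurable G := by
    have h1 : Measurable fun ξ : EuclideanSpace ℝ (Fin 3) => ENNReal.ofReal ((1 + ‖ξ‖ ^ 2) ^ s) :=
      ENNReal.measurable_ofReal.comp ((measurable_const.add (measurable_norm.pow_const 2)).pow_const s)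
    have h2 : Measurable fun ξ : EuclideanSpace ℝ (Fin 3) => ‖fourierFn y ξ‖ₑ ^ 2 := by
      unfold fourierFn
      exact (Lp.stronglyMeasurable _).measurable.enorm.pow_const 2
    exact h1.mul h2
  have hrepr : ∀ t, Literature.Analysis.FunctionSpaces.eFourierSobolevNorm s (heat t y - heat t₀ y) =
      (∫⁻ ξ, ‖heatSymbol t ξ - heatSymbol t₀ ξ‖ₑ ^ 2 * G ξ) ^ (1 / 2 : ℝ) := by
    intro t
    rw [eFourierSobolevNorm_eq, sobolevWeightIntegral_congr_ae (fourierFn_heat_sub_heat t t₀ y)]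
    unfold sobolevWeightIntegral
    congr 1
    refine lintegral_congr fun ξ => ?_
    rw [hG]
    dsimp only
    rw [enorm_smul, mul_pow]
    ring
  have hlin : Tendsto (fun t => ∫⁻ ξ, ‖heatSymbol t ξ - heatSymbol t₀ ξ‖ₑ ^ 2 * G ξ) (𝓝 t₀) (𝓝 0) := by
    rw [← lintegral_zero (μ := (volume : Measure (EuclideanSpace ℝ (Fin 3))))]
    refine tendsto_lintegral_filter_of_dominated_convergence (fun ξ => 4 * G ξ) ?_ ?_ ?_ ?_
    · refine Eventually.of_forall fun t => ?_
      exact (((continuous_heatSymbol t).sub (continuous_heatSymbol t₀)).measurable.enorm.pow_const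
        2).mul hGmeas
    · refine Eventually.of_forall fun t => Eventually.of_forall fun ξ => ?_
      have hle : ‖heatSymbol t ξ - heatSymbol t₀ ξ‖ₑ ≤ 2 := by
        rw [← ofReal_norm, ← ENNReal.ofReal_ofNat]
        refine ENNReal.ofReal_le_ofReal ((norm_sub_le _ _).trans ?_)
        have := norm_heatSymbol_le t ξ
        have := norm_heatSymbol_le t₀ ξ
        linarith
      calc ‖heatSymbol t ξ - heatSymbol t₀ ξ‖ₑ ^ 2 * G ξ ≤ 2 ^ 2 * G ξ := by gcongr
        _ = 4 * G ξ := by norm_num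
    · rw [lintegral_const_mul _ hGmeas]
      exact ENNReal.mul_ne_top (by norm_num) hGfin.ne
    · refine Eventually.of_forall fun ξ => ?_
      have h1 : Tendsto (fun t => heatSymbol t ξ - heatSymbol t₀ ξ) (𝓝 t₀) (𝓝 0) := by
        have hc : Continuous fun t : ℝ => heatSymbol t ξ - heatSymbol t₀ ξ :=
          (continuous_heatSymbol_time ξ).sub continuous_const
        simpa using hc.tendsto t₀
      have h2 : Tendsto (fun t => ‖heatSymbol t ξ - heatSymbol t₀ ξ‖ₑ ^ 2) (𝓝 t₀) (𝓝 0) := by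
        have h3 := ((ENNReal.continuous_pow 2).tendsto _).comp h1.enorm
        simp only [enorm_zero, ne_eq, OfNat.ofNat_ne_zero, not_false_eq_true, zero_pow] at h3
        exact h3
      have h4 := ENNReal.Tendsto.mul_const h2 (Or.inr (by
        rw [hG]
        exact ENNReal.mul_ne_top ENNReal.ofReal_ne_top (ENNReal.pow_ne_top enorm_ne_top)) :
          (0 : ℝ≥0∞) ≠ 0 ∨ G ξ ≠ ⊤)
      simpa using h4
  have hfin := ((ENNReal.continuous_rpow_const (y := (1 / 2 : ℝ))).tendsto 0).comp hlin
  rw [ENNReal.zero_rpow_of_pos (by norm_num : (0 : ℝ) < 1 / 2)] at hfin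
  refine hfin.congr fun t => ?_
  rw [Function.comp_apply, hrepr]

/-- Hence `t ↦ e^{tΔ} y` is `H¹⁰`-continuous on every time set when `‖y‖_{H¹⁰} < ∞`. -/
theorem continuousInH10On_heat {y : L2C} (hy : Literature.Analysis.FunctionSpaces.eFourierSobolevNorm 10 y < ∞)
    (I : Set ℝ) : ContinuousInH10On I (fun t => heat t y) := fun t₀ _ =>
  (tendsto_eFourierSobolevNorm_heat_sub hy t₀).mono_left nhdsWithin_le_nhds

/-- **The heat point `θ = 0` is not a member**: every `H¹⁰_df`-mild heat flow from Schwartz data on `[0,S)`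
extends (`t ↦ e^{tΔ}u(0)` on `[0,S+1)`), so `0 ∉ btSet (segForm zero) M` for every `M`. -/
theorem zero_notMem_btSet_zeroDatum (M : ℝ) : (0 : ℝ) ∉ btSet (segForm AveragingDatum.zero) M := by
  intro h
  simp only [btSet, mem_setOf_eq, segForm_zeroDatum] at h
  obtain ⟨-, u₀, -, S, hS, u, hu, -, hno⟩ := h
  have hT0 : ∀ a b c : L2C, ((0 : ℝ) : ℂ) * eulerForm a b c = 0 := fun a b c => by simp
  have hy : MemH10df (u 0) := hu.1 0 ⟨le_rfl, hS⟩
  have hinit : ∀ w, MemH10df w → pairing (u 0) w = pairing (schwartzL2 u₀) w :=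
    fun w hw => hu.initial ⟨le_rfl, hS⟩ hw
  have hheat : ∀ (t : ℝ) (w : L2C), MemH10df w →
      pairing (heat t (u 0)) w = pairing (heat t (schwartzL2 u₀)) w := by
    intro t w hw
    rw [pairing_heat_left, pairing_heat_left, hinit _ (hw.heat t)]
  have hut : ∀ t ∈ Ico 0 S, ∀ w, MemH10df w → pairing (u t) w = pairing (heat t (schwartzL2 u₀)) w := by
    intro t ht w hw
    have h := hu.2.2 t ht w hw
    simp only [hT0, intervalIntegral.integral_zero, add_zero] at h
    exact h
  refine hno ⟨S + 1, by linarith, fun t => heat t (u 0), ⟨fun t _ => hy.heat t,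
    continuousInH10On_heat hy.1 _, fun t _ w hw => ?_⟩, fun t ht => ?_⟩
  · simp only [hT0, intervalIntegral.integral_zero, add_zero]
    exact hheat t w hw
  · have h1 : MemH10df (heat t (u 0) - u t) := (hy.heat t).sub (hu.1 t ht)
    have h0 : pairing (heat t (u 0) - u t) (heat t (u 0) - u t) = 0 := by
      rw [pairing_sub_left, hheat t _ h1, hut t ht _ h1, sub_self]
    exact sub_eq_zero.1 (eq_zero_of_pairing_self_eq_zero h1.2.1 h0)

/-- **The zero-datum blow-up set IS the rescaled NS Type-I ceiling set**:
`btSet (segForm zero) M = {θ ∈ (0,1] | NSTypeICeiling (θM)}` exactly. -/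
theorem btSet_zeroDatum_eq (M : ℝ) :
    btSet (segForm AveragingDatum.zero) M = {θ : ℝ | θ ∈ Ioc 0 1 ∧ NSTypeICeiling (θ * M)} := by
  ext θ
  constructor
  · intro h
    obtain ⟨hle, h1⟩ := h.1
    rcases hle.eq_or_lt with h0 | h0
    · subst h0
      exact absurd h (zero_notMem_btSet_zeroDatum M)
    · exact ⟨⟨h0, h1⟩, (mem_btSet_zeroDatum_iff h0 h1).1 h⟩
  · rintro ⟨⟨h0, h1⟩, h⟩
    exact (mem_btSet_zeroDatum_iff h0 h1).2 h

/-- **The zero-datum instance of the crux is a pure Navier–Stokes statement**: for every `M`,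
`IsClosed (btSet (segForm zero) M) ↔ IsClosed {θ ∈ (0,1] | NSTypeICeiling (θM)}` — an up-ray of `(0,1]`
(`nsTypeICeiling_mono`), closed iff empty or `[θ₀,1]` with `θ₀ > 0` (attainment, plus a positive floor). -/
theorem isClosed_btSet_zeroDatum_iff (M : ℝ) :
    IsClosed (btSet (segForm AveragingDatum.zero) M) ↔
      IsClosed {θ : ℝ | θ ∈ Ioc 0 1 ∧ NSTypeICeiling (θ * M)} := by
  rw [btSet_zeroDatum_eq]

/-- **The crux proves NS attainment.** `BoundedTemperatureClosed → ∀ K > 0, (∀ K' > K, NSTypeICeiling K') →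
NSTypeICeiling K`: apply the crux to the zero datum at ceiling `2K`; `(1/2, 1]` consists of members, so
closedness puts `1/2` in the set, i.e. Navier–Stokes blows up at Type-I ceiling `K`. Any proof of the crux as
quantified must therefore settle the attainment of the infimal Type-I constant of Navier–Stokes. -/
theorem nsTypeICeiling_attained_of_crux (h : Theses.PumpContinuation.BoundedTemperatureClosed) {K : ℝ}
    (hK : 0 < K) (hall : ∀ K' : ℝ, K < K' → NSTypeICeiling K') : NSTypeICeiling K := by
  have hcl : IsClosed (btSet (segForm AveragingDatum.zero) (2 * K)) :=
    h AveragingDatum.zero zeroDatum_isSymmetric_hasCancellation.1 zeroDatum_isSymmetric_hasCancellation.2 _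
  have hmem : ∀ θ : ℝ, 1 / 2 < θ → θ ≤ 1 → θ ∈ btSet (segForm AveragingDatum.zero) (2 * K) := by
    intro θ h1 h2
    refine (mem_btSet_zeroDatum_iff (by linarith) h2).2 (hall _ ?_)
    nlinarith [mul_pos hK (by linarith : (0 : ℝ) < 2 * θ - 1)]
  have hhalf : (1 / 2 : ℝ) ∈ closure (btSet (segForm AveragingDatum.zero) (2 * K)) := by
    rw [Metric.mem_closure_iff]
    intro ε hε
    have hb1 : (1 / 2 : ℝ) < min 1 (1 / 2 + ε / 2) := lt_min (by norm_num) (by linarith)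
    have hb2 : min 1 (1 / 2 + ε / 2) ≤ 1 / 2 + ε / 2 := min_le_right _ _
    refine ⟨min 1 (1 / 2 + ε / 2), hmem _ hb1 (min_le_left _ _), ?_⟩
    rw [Real.dist_eq, abs_of_nonpos (by linarith)]
    linarith
  rw [hcl.closure_eq] at hhalf
  have hNS := (mem_btSet_zeroDatum_iff (by norm_num : (0 : ℝ) < 1 / 2) (by norm_num)).1 hhalf
  rwa [show (1 / 2 : ℝ) * (2 * K) = K by ring] at hNS

/-- **`H` (not constructible here): the infimal Type-I constant of Navier–Stokes is not attained** — some
`K > 0` is not an NS Type-I ceiling although every `K' > K` is. Contains a Millennium counterexample. -/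
def TypeIInfimumNotAttainedNS : Prop :=
  ∃ K : ℝ, 0 < K ∧ ¬ NSTypeICeiling K ∧ ∀ K' : ℝ, K < K' → NSTypeICeiling K'

/-- **Negative lemma: `¬ BoundedTemperatureClosed` modulo `TypeIInfimumNotAttainedNS`** (witness: the zero
datum, ceiling `2K`, blow-up set `∩ (0,1] = (1/2, 1]`). -/
theorem crux_false_of_typeIInfimumNotAttainedNS (hH : TypeIInfimumNotAttainedNS) :
    ¬ Theses.PumpContinuation.BoundedTemperatureClosed := fun h => by
  obtain ⟨K, hK, hnot, hall⟩ := hH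
  exact hnot (nsTypeICeiling_attained_of_crux h hK hall)

end ZeroDatum

/-! ### (h) Briefing facts for provers (positive, cheap): the segment keeps symmetry and (1.16)

Uniformly in `θ`, `T_θ` is symmetric on `H¹⁰_df` and satisfies the cancellation identity `T_θ(u,u,u) = 0`
(so the energy inequality of Tao 2016 Remark 1.6 holds along the whole segment with constants independent of
`θ`); together with the earlier remark that `T_θ` is the form of a mixture datum, the in-tree `H¹⁰_df` local
theory applies uniformly in `θ ∈ [0,1]`. -/

/-- The segment forms inherit the cancellation property (1.16), uniformly in `θ`. -/
theorem segForm_diag_eq_zero {𝒜 : AveragingDatum} (hc : 𝒜.HasCancellation) (θ : ℝ) {u : L2C}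
    (hu : MemH10df u) : segForm 𝒜 θ u u u = 0 := by
  have hB : eulerForm u u u = 0 := by
    rw [← AveragingDatum.euler_form]
    exact AveragingDatum.euler_hasCancellation u hu
  simp [segForm, hc u hu, hB]

/-- The segment forms inherit symmetry on `H¹⁰_df`, uniformly in `θ`. -/
theorem segForm_symm {𝒜 : AveragingDatum} (hs : 𝒜.IsSymmetric) (θ : ℝ) {u v w : L2C}
    (hu : MemH10df u) (hv : MemH10df v) (hw : MemH10df w) :
    segForm 𝒜 θ u v w = segForm 𝒜 θ v u w := by
  simp only [segForm, hs u v w hu hv hw, eulerForm_symm u v w]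

end Summit.NavierStokesRegularity.NavierStokesRegularity.Cruxes.BoundedTemperatureClosed.Disproof
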